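import Literature.NumberTheory.EllipticCurves.ModularFormsLevelCusps
import Literature.NumberTheory.EllipticCurves.ModularFormsGamma1RankInput
import Literature.NumberTheory.EllipticCurves.ModularFormsGamma0DimensionIneqProofs
import HarnessLib

/-!
# The dimension of `M_k(Γ₁(N))` in even weight and the lower bound for `dim S_k(Γ₁(N))` in every
# even weight (Diamond–Shurman Thm. 3.5.1 / Fig. 3.4 for `Γ₁(N)`, `N ≥ 4`), by the free-module
# route — the dimension input of the rank half of Eichler–Shimura on `Γ₁(N)`

Assembly of the `Γ₁(N)` free-module route (`ModularFormsLevelFreeModule`, `ModularFormsLevelRank`,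
`ModularFormsLevelCusps`, `ModularFormsGamma1PlusMinus`, `ModularFormsGamma1ExplicitForms`,
`ModularFormsGamma1RankInput`): for `N ≥ 4` the graded `ℂ[E₄, E₆]`-module
`M(±Γ₁(N)) = ⊕_{k even} M_k(Γ₁(N))` is free on `μ₁ = [SL₂(ℤ) : ±Γ₁(N)] = φ(N)μ/2` generators of even
weights `k_j ≥ 0`, equidistributed modulo `4` and modulo `6` (no elliptic points) and with
`∑ k_j = 6(μ₁ - ε_∞)`, where throughout `ε_∞ := #Level.basePoints (±Γ₁(N))` = the number of
`⟨T⟩`-orbits on `SL₂(ℤ)/±Γ₁(N)` (classically the number of cusps of `Γ₁(N)`; that identification is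
neither proved nor used, and the statements carry the orbit count itself). Summing the per-weight identity
`12 dim R_w + 6[4 ∤ w] + 8[w ≡ 2 (6)] + 4[w ≡ 4 (6)] = w + 12` (`w ≥ 0`,
`twelve_mul_finrank_levelOneSpace` of `ModularFormsGamma0Dimension`), resp. the per-weight
inequality `w + 12 ≤ 12 dim R_w + …` valid for every even `w` (`twelve_mul_finrank_levelOneSpace_ge`
of `ModularFormsGamma0DimensionIneqProofs`), over `w = k - k_j` gives

  `12 dim M_k(Γ₁(N)) = (k - 1) μ₁ + 6 ε_∞`  for even `k ≥ 6μ₁ ≥ max k_j`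
    (`twelve_mul_finrank_modularForm_gamma1`),
  `12 dim M_k(Γ₁(N)) ≥ (k - 1) μ₁ + 6 ε_∞`  for every even `k`
    (`twelve_mul_finrank_modularForm_gamma1_ge`),

i.e. `dim M_k(Γ₁(N)) = (k-1)(g-1) + (k/2) ε_∞` with `12(g - 1) = μ₁ - 6ε_∞` (Diamond–Shurman Thm. 3.5.1
with `ε₂ = ε₃ = 0`, Fig. 3.4), and, since the cusp-value map `M_k → ℂ^{ε_∞}` has kernel inside `S_k`
(`Level.finrank_levelSpace_le_finrank_cuspForm_add`, any weight), **for every even `k`**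

  `12 dim S_k(Γ₁(N)) ≥ (k - 1) μ₁ - 6 ε_∞`   (`le_twelve_mul_finrank_cuspForm_gamma1`,
  `sub_one_mul_index_le_finrank_cuspForm_gamma1`)

— the existence half of the dimension formula (for `k ≥ 4` the right-hand side is `12` times the
exact dimension `(k-1)(g-1) + (k/2 - 1)ε_∞`), which is the dimension input `dim S_k(Γ₁(N)) ≥ h_P/2`
of the rank half of the Eichler–Shimura isomorphism for `Γ₁(N)` (with `h_P = (k-1)μ₁/6 - ε_∞` the
rank of the weight-`k` parabolic cohomology computed from the same coset space). All proved; no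
named facts. Odd weights, `N ≤ 3`, and the exact value of `dim S_k` (Eisenstein series at every
cusp) are deliberately not treated.

## References

* F. Diamond, J. Shurman, *A first course in modular forms*, GTM 228, Springer (2005), Thm. 3.5.1,
  Thm. 3.6.1 and Fig. 3.4 (dimension formulas for `Γ₁(N)`), §3.8–3.9.
* G. Shimura, *Introduction to the arithmetic theory of automorphic functions* (1971), Thm. 2.23,
  Prop. 1.40.
* T. Gannon, *The theory of vector-valued modular forms for the modular group* (2014), Thm. 3.4, §3.5.
-/

noncomputable section

open UpperHalfPlane hiding I
open ModularForm Complex Matrix.SpecialLinearGroup Filter Asymptotics CongruenceSubgroup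
open EisensteinSeries ModularGroup
open scoped MatrixGroups Real ModularForm Topology Manifold

namespace Literature.NumberTheory.EllipticCurves.ModularForms

/-! ### The cusp-value map in weight `k` for a level `Γ`: `dim M_k(Γ) ≤ dim S_k(Γ) + ε_∞(Γ)` -/

namespace Level

section CuspValues

variable {Γ : Subgroup SL(2, ℤ)} [Γ.FiniteIndex] {k : ℤ}

local notation "𝕏" => SL(2, ℤ) ⧸ Γ

open scoped Classical

/-- The local `Fintype` structure on the coset space. [folklore] -/
local instance fintypeCosetLevelDimension : Fintype (SL(2, ℤ) ⧸ Γ) := Fintype.ofFinite _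

/-- Conjugates of `Γ`-forms tend to their value at `i∞`. [folklore] -/
theorem tendsto_cosetSlash {f : ℍ → ℂ} (hf : f ∈ levelSpace Γ k) (x : 𝕏) :
    Tendsto (cosetSlash Γ k f x) atImInfty (𝓝 (valueAtInfty (cosetSlash Γ k f x))) :=
  tendsto_valueAtInfty_of_periodic (width_pos Γ x) (cosetSlash_T_pow_width_smul hf x)
    (mdifferentiable_cosetSlash hf x) (isBoundedAtImInfty_cosetSlash hf x)

/-- The value at `i∞` is constant along `T`-orbits: `v(f ∣ x) = v(f ∣ base x)`. [folklore] -/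
theorem valueAtInfty_cosetSlash_eq_base {f : ℍ → ℂ} (hf : f ∈ levelSpace Γ k) (x : 𝕏) :
    valueAtInfty (cosetSlash Γ k f x) = valueAtInfty (cosetSlash Γ k f (base Γ x)) := by
  have hx : cosetSlash Γ k f x = transl (-(off Γ x : ℤ)) (cosetSlash Γ k f (base Γ x)) := by
    rw [transl_cosetSlash hf, T_pow_off_smul_base]
  rw [hx]
  exact ((tendsto_cosetSlash hf (base Γ x)).comp (tendsto_T_zpow_smul_atImInfty _)).limUnder_eq

variable (Γ k) in
/-- The **cusp-value functional** `f ↦ v(f ∣ x)` on `M_k(Γ)`. [folklore] -/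
def cuspValueK (x : 𝕏) : levelSpace Γ k →ₗ[ℂ] ℂ where
  toFun f := valueAtInfty (cosetSlash Γ k (f : ℍ → ℂ) x)
  map_add' f g := by
    have hadd : cosetSlash Γ k ((f : ℍ → ℂ) + g) x =
        cosetSlash Γ k (f : ℍ → ℂ) x + cosetSlash Γ k (g : ℍ → ℂ) x :=
      SlashAction.add_slash _ _ _ _
    simp only [Submodule.coe_add]
    rw [hadd]
    exact ((tendsto_cosetSlash f.2 x).add (tendsto_cosetSlash g.2 x)).limUnder_eq
  map_smul' c f := by
    have hsmul : cosetSlash Γ k (c • (f : ℍ → ℂ)) x = c • cosetSlash Γ k (f : ℍ → ℂ) x := by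
      unfold cosetSlash
      rw [← ModularForm.SL_slash, ModularForm.SL_smul_slash, ModularForm.SL_slash]
    simp only [Submodule.coe_smul, RingHom.id_apply]
    rw [hsmul]
    exact ((tendsto_cosetSlash f.2 x).const_smul c).limUnder_eq

variable (Γ k) in
/-- The cusp-value map `M_k(Γ) → ℂ^{base points}` (one coordinate per `⟨T⟩`-orbit). [folklore] -/
def cuspValuesK : levelSpace Γ k →ₗ[ℂ] ({x // x ∈ basePoints Γ} → ℂ) :=
  LinearMap.pi fun b ↦ cuspValueK Γ k b.1

/-- A `Γ`-form of weight `k` all of whose conjugates vanish at `i∞` is a cusp form. [folklore] -/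
def cuspFormOfVanishingK (f : ℍ → ℂ) (hf : f ∈ levelSpace Γ k)
    (h0 : ∀ γ : SL(2, ℤ), IsZeroAtImInfty (f ∣[k] (γ : GL (Fin 2) ℝ))) : CuspForm Γ k where
  toFun := f
  slash_action_eq' γ hγ := slash_eq_of_mem_formSpace hf hγ
  holo' := mdifferentiable_of_mem_formSpace hf
  zero_at_cusps' {c} hc := by
    rw [Subgroup.IsArithmetic.isCusp_iff_isCusp_SL2Z] at hc
    rw [OnePoint.isZeroAt_iff_forall_SL2Z hc]
    intro γ _
    exact h0 γ

/-- Members of `ker(cuspValuesK)` vanish at every cusp. [folklore] -/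
theorem isZeroAtImInfty_of_mem_ker_cuspValuesK {f : levelSpace Γ k}
    (hf : f ∈ LinearMap.ker (cuspValuesK Γ k)) (γ : SL(2, ℤ)) :
    IsZeroAtImInfty ((f : ℍ → ℂ) ∣[k] (γ : GL (Fin 2) ℝ)) := by
  have hx : ∀ x : 𝕏, valueAtInfty (cosetSlash Γ k (f : ℍ → ℂ) x) = 0 := by
    intro x
    rw [valueAtInfty_cosetSlash_eq_base f.2]
    exact congr_fun (LinearMap.mem_ker.mp hf) ⟨base Γ x, base_mem_basePoints x⟩
  have heq : (f : ℍ → ℂ) ∣[k] (γ : GL (Fin 2) ℝ) =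
      cosetSlash Γ k (f : ℍ → ℂ) ((γ⁻¹ : SL(2, ℤ)) : 𝕏) := by
    rw [cosetSlash_mk (slash_eq_of_mem_levelSpace f.2), inv_inv]
  rw [heq]
  have := tendsto_cosetSlash f.2 ((γ⁻¹ : SL(2, ℤ)) : 𝕏)
  rwa [hx] at this

variable (Γ k) in
/-- The inclusion `ker(cuspValuesK) → S_k(Γ)`. [folklore] -/
def kerToCuspFormK : LinearMap.ker (cuspValuesK Γ k) →ₗ[ℂ] CuspForm Γ k where
  toFun f := cuspFormOfVanishingK (f.1 : ℍ → ℂ) f.1.2 (isZeroAtImInfty_of_mem_ker_cuspValuesK f.2)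
  map_add' f g := by ext τ; rfl
  map_smul' c f := by ext τ; rfl

/-- The inclusion is injective. [folklore] -/
theorem kerToCuspFormK_injective : Function.Injective (kerToCuspFormK Γ k) := by
  intro f g h
  apply Subtype.ext
  apply Subtype.ext
  funext τ
  exact congrArg (fun G : CuspForm Γ k ↦ G τ) h

variable (Γ k) in
/-- **`dim M_k(Γ) ≤ dim S_k(Γ) + ε_∞(Γ)`** (`ε_∞ = #basePoints`), in every weight, for finite-
dimensional `S_k(Γ)`: the cusp-value map to `ℂ^{ε_∞}` has kernel consisting of cusp forms.
[folklore] -/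
theorem finrank_levelSpace_le_finrank_cuspForm_add [Fact (ModularGroup.T ∈ Γ)]
    [FiniteDimensional ℂ (CuspForm Γ k)] :
    Module.finrank ℂ (levelSpace Γ k) ≤ Module.finrank ℂ (CuspForm Γ k) + (basePoints Γ).card := by
  have hrn := LinearMap.finrank_range_add_finrank_ker (cuspValuesK Γ k)
  have h1 : Module.finrank ℂ (LinearMap.range (cuspValuesK Γ k)) ≤ (basePoints Γ).card := by
    have := Submodule.finrank_le (LinearMap.range (cuspValuesK Γ k))
    rwa [Module.finrank_fintype_fun_eq_card, Fintype.card_coe] at this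
  have h3 : Module.finrank ℂ (LinearMap.ker (cuspValuesK Γ k)) ≤ Module.finrank ℂ (CuspForm Γ k) :=
    LinearMap.finrank_le_finrank_of_injective (kerToCuspFormK_injective (Γ := Γ) (k := k))
  omega

end CuspValues

end Level

/-! ### `12 dim M_k(Γ₁(N)) = (k-1)μ₁ + 6ε_∞` and `12 dim S_k(Γ₁(N)) ≥ (k-1)μ₁ - 6ε_∞` -/

section Gamma1Dimension

variable {N : ℕ} [NeZero N]

/-! Throughout, `ε_∞` stands for `#Level.basePoints (±Γ₁(N))`, the number of `⟨T⟩`-orbits on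
`SL₂(ℤ)/±Γ₁(N)` (`Level.basePointsEquiv`); its identification with the number of cusps of `Γ₁(N)`
(Diamond–Shurman §3.8) is not proved or used here, so the statements carry the orbit count itself. -/

/-- The residues of `k - k_j` modulo `4` for even `k`: `2#{4 ∤ k - k_j} = μ₁` (the `k_j` are
equidistributed modulo `4`, `card_constraints_gamma1pm`). [folklore] -/
theorem two_mul_card_not_four_dvd_sub_gamma1pm (hN : 4 ≤ N)
    {wt : Fin (Gamma1pm N).index → ℤ} {F : Fin (Gamma1pm N).index → ℍ → ℂ}
    (hb : Level.IsLevelBasis (Gamma1pm N) wt F) (hwt : ∀ j, 0 ≤ wt j ∧ Even (wt j))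
    {k : ℤ} (hk : Even k) :
    2 * ((Finset.univ.filter fun j ↦ ¬ (4 : ℤ) ∣ k - wt j).card : ℤ) = (Gamma1pm N).index := by
  classical
  obtain ⟨h40, h42, -, -, -⟩ := card_constraints_gamma1pm hN hb hwt
  by_cases hk4 : (4 : ℤ) ∣ k
  · have heq : (Finset.univ.filter fun j ↦ ¬ (4 : ℤ) ∣ k - wt j) =
        Finset.univ.filter fun j ↦ ¬ (4 : ℤ) ∣ wt j :=
      Finset.filter_congr fun j _ ↦ by obtain ⟨a, ha⟩ := (hwt j).2; omega
    rw [heq]; exact_mod_cast h42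
  · have heq : (Finset.univ.filter fun j ↦ ¬ (4 : ℤ) ∣ k - wt j) =
        Finset.univ.filter fun j ↦ (4 : ℤ) ∣ wt j :=
      Finset.filter_congr fun j _ ↦ by
        obtain ⟨a, ha⟩ := (hwt j).2
        obtain ⟨b, hb⟩ := hk
        omega
    rw [heq]; exact_mod_cast h40

/-- The residues of `k - k_j` modulo `6` for even `k`: `3(8#{k - k_j ≡ 2} + 4#{k - k_j ≡ 4}) = 12μ₁`
(the `k_j` are equidistributed modulo `6`, `card_constraints_gamma1pm`). [folklore] -/
theorem three_mul_card_sub_mod_six_gamma1pm (hN : 4 ≤ N)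
    {wt : Fin (Gamma1pm N).index → ℤ} {F : Fin (Gamma1pm N).index → ℍ → ℂ}
    (hb : Level.IsLevelBasis (Gamma1pm N) wt F) (hwt : ∀ j, 0 ≤ wt j ∧ Even (wt j))
    {k : ℤ} (hk : Even k) :
    3 * (8 * ((Finset.univ.filter fun j ↦ (k - wt j) % 6 = 2).card : ℤ) +
      4 * ((Finset.univ.filter fun j ↦ (k - wt j) % 6 = 4).card : ℤ)) = 12 * (Gamma1pm N).index := by
  classical
  obtain ⟨-, -, h60, h62, h64⟩ := card_constraints_gamma1pm hN hb hwt
  obtain ⟨b, hbk⟩ := hk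
  have hcases : k % 6 = 0 ∨ k % 6 = 2 ∨ k % 6 = 4 := by omega
  -- each residue class of `k - k_j` modulo `6` is one of the three classes of `k_j`
  have hcl : ∀ r : ℤ, (r = 2 ∨ r = 4) →
      3 * ((Finset.univ.filter fun j ↦ (k - wt j) % 6 = r).card : ℤ) = (Gamma1pm N).index := by
    intro r hr
    rcases hcases with h0 | h2 | h4 <;> rcases hr with rfl | rfl
    · have e : (Finset.univ.filter fun j ↦ (k - wt j) % 6 = 2) = Finset.univ.filter fun j ↦ wt j % 6 = 4 :=
        Finset.filter_congr fun j _ ↦ by obtain ⟨a, ha⟩ := (hwt j).2; omega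
      rw [e]; exact_mod_cast h64
    · have e : (Finset.univ.filter fun j ↦ (k - wt j) % 6 = 4) = Finset.univ.filter fun j ↦ wt j % 6 = 2 :=
        Finset.filter_congr fun j _ ↦ by obtain ⟨a, ha⟩ := (hwt j).2; omega
      rw [e]; exact_mod_cast h62
    · have e : (Finset.univ.filter fun j ↦ (k - wt j) % 6 = 2) = Finset.univ.filter fun j ↦ (6 : ℤ) ∣ wt j :=
        Finset.filter_congr fun j _ ↦ by obtain ⟨a, ha⟩ := (hwt j).2; omega
      rw [e]; exact_mod_cast h60
    · have e : (Finset.univ.filter fun j ↦ (k - wt j) % 6 = 4) = Finset.univ.filter fun j ↦ wt j % 6 = 4 :=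
        Finset.filter_congr fun j _ ↦ by obtain ⟨a, ha⟩ := (hwt j).2; omega
      rw [e]; exact_mod_cast h64
    · have e : (Finset.univ.filter fun j ↦ (k - wt j) % 6 = 2) = Finset.univ.filter fun j ↦ wt j % 6 = 2 :=
        Finset.filter_congr fun j _ ↦ by obtain ⟨a, ha⟩ := (hwt j).2; omega
      rw [e]; exact_mod_cast h62
    · have e : (Finset.univ.filter fun j ↦ (k - wt j) % 6 = 4) = Finset.univ.filter fun j ↦ (6 : ℤ) ∣ wt j :=
        Finset.filter_congr fun j _ ↦ by obtain ⟨a, ha⟩ := (hwt j).2; omega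
      rw [e]; exact_mod_cast h60
  have h2 := hcl 2 (Or.inl rfl)
  have h4 := hcl 4 (Or.inr rfl)
  omega

/-- **The dimension of `M_k(±Γ₁(N))` from a level-one basis** (`N ≥ 4`): for even `k ≥ max k_j`,
`12 dim M_k = (k-1)μ₁ + 6ε_∞` (per-weight identity summed, weights equidistributed modulo `4` and
`6`, cusp constraint `∑ k_j = 6(μ₁ - ε_∞)`). [cite: DiamondShurman2005, Thm. 3.5.1] -/
theorem twelve_mul_finrank_levelSpace_gamma1pm (hN : 4 ≤ N)
    {wt : Fin (Gamma1pm N).index → ℤ} {F : Fin (Gamma1pm N).index → ℍ → ℂ}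
    (hb : Level.IsLevelBasis (Gamma1pm N) wt F) (hwt : ∀ j, 0 ≤ wt j ∧ Even (wt j))
    {k : ℤ} (hk : Even k) (hkw : ∀ j, wt j ≤ k) :
    12 * (Module.finrank ℂ (Level.levelSpace (Gamma1pm N) k) : ℤ) =
      (k - 1) * (Gamma1pm N).index + 6 * (Level.basePoints (Gamma1pm N)).card := by
  classical
  have hN3 : 3 ≤ N := by omega
  have hK := Level.totalWeight_eq hb (rankInputGamma1pm N hN3) hwt
  have hS4 := two_mul_card_not_four_dvd_sub_gamma1pm hN hb hwt hk
  have hS6 := three_mul_card_sub_mod_six_gamma1pm hN hb hwt hk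
  -- sum the per-weight identity
  have hsum := Finset.sum_congr (rfl : (Finset.univ : Finset (Fin (Gamma1pm N).index)) = _)
    fun j (_ : j ∈ (Finset.univ : Finset (Fin (Gamma1pm N).index))) ↦
      twelve_mul_finrank_levelOneSpace (w := k - wt j) (by linarith [hkw j]) (hk.sub (hwt j).2)
  simp only [Finset.sum_add_distrib, ← Finset.mul_sum, Finset.sum_boole, Finset.sum_sub_distrib,
    Finset.sum_const, Finset.card_univ, Fintype.card_fin, nsmul_eq_mul] at hsum
  rw [hb.finrank_eq k]
  push_cast
  unfold Level.totalWeight at hK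
  nlinarith [hsum, hK, hS4, hS6]

/-- **The dimension inequality for `M_k(±Γ₁(N))` from a level-one basis, every even `k`**
(`N ≥ 4`): `(k-1)μ₁ + 6ε_∞ ≤ 12 dim M_k` — the per-weight *inequality*
`w + 12 ≤ 12 dim R_w + 6[4 ∤ w] + 8[w ≡ 2 (6)] + 4[w ≡ 4 (6)]` (`twelve_mul_finrank_levelOneSpace_ge`,
valid also for `w = k - k_j < 0`) summed over the generators. [cite: DiamondShurman2005, Thm. 3.5.1] -/
theorem le_twelve_mul_finrank_levelSpace_gamma1pm (hN : 4 ≤ N)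
    {wt : Fin (Gamma1pm N).index → ℤ} {F : Fin (Gamma1pm N).index → ℍ → ℂ}
    (hb : Level.IsLevelBasis (Gamma1pm N) wt F) (hwt : ∀ j, 0 ≤ wt j ∧ Even (wt j))
    {k : ℤ} (hk : Even k) :
    (k - 1) * (Gamma1pm N).index + 6 * (Level.basePoints (Gamma1pm N)).card ≤
      12 * (Module.finrank ℂ (Level.levelSpace (Gamma1pm N) k) : ℤ) := by
  classical
  have hN3 : 3 ≤ N := by omega
  have hK := Level.totalWeight_eq hb (rankInputGamma1pm N hN3) hwt
  have hS4 := two_mul_card_not_four_dvd_sub_gamma1pm hN hb hwt hk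
  have hS6 := three_mul_card_sub_mod_six_gamma1pm hN hb hwt hk
  -- sum the per-weight inequality
  have hsum := Finset.sum_le_sum
    fun j (_ : j ∈ (Finset.univ : Finset (Fin (Gamma1pm N).index))) ↦
      twelve_mul_finrank_levelOneSpace_ge (w := k - wt j) (hk.sub (hwt j).2)
  simp only [Finset.sum_add_distrib, ← Finset.mul_sum, Finset.sum_boole, Finset.sum_sub_distrib,
    Finset.sum_const, Finset.card_univ, Fintype.card_fin, nsmul_eq_mul] at hsum
  rw [hb.finrank_eq k]
  push_cast
  unfold Level.totalWeight at hK
  nlinarith [hsum, hK, hS4, hS6]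

/-- A generator weight is at most the total weight, hence `≤ 6μ₁`. [folklore] -/
theorem wt_le_of_isLevelBasis (hN : 3 ≤ N)
    {wt : Fin (Gamma1pm N).index → ℤ} {F : Fin (Gamma1pm N).index → ℍ → ℂ}
    (hb : Level.IsLevelBasis (Gamma1pm N) wt F) (hwt : ∀ j, 0 ≤ wt j ∧ Even (wt j)) (j : Fin (Gamma1pm N).index) :
    wt j ≤ 6 * ((Gamma1pm N).index : ℤ) := by
  have hK := Level.totalWeight_eq hb (rankInputGamma1pm N hN) hwt
  have h1 : wt j ≤ Level.totalWeight (Gamma1pm N) wt := by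
    unfold Level.totalWeight
    exact Finset.single_le_sum (fun i _ ↦ (hwt i).1) (Finset.mem_univ j)
  have h2 : (0 : ℤ) ≤ (Level.basePoints (Gamma1pm N)).card := Int.natCast_nonneg _
  linarith

variable (N)

/-- **`12 dim M_k(Γ₁(N)) = (k-1)[SL₂(ℤ):±Γ₁(N)] + 6ε_∞(N)` for `N ≥ 4` and every even
`k ≥ 6[SL₂(ℤ):±Γ₁(N)]`** (Diamond–Shurman Thm. 3.5.1 / Fig. 3.4 for `Γ₁(N)` in these weights:
`dim M_k = (k-1)(g-1) + (k/2)ε_∞` with `12(g-1) = μ₁ - 6ε_∞`), without Riemann–Roch.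
[cite: DiamondShurman2005, Thm. 3.5.1] -/
theorem twelve_mul_finrank_modularForm_gamma1 (hN : 4 ≤ N) {k : ℤ} (hk : Even k)
    (hk6 : 6 * ((Gamma1pm N).index : ℤ) ≤ k) :
    12 * (Module.finrank ℂ (ModularForm (Gamma1 N) k) : ℤ) =
      (k - 1) * (Gamma1pm N).index + 6 * (Level.basePoints (Gamma1pm N)).card := by
  have hN3 : 3 ≤ N := by omega
  obtain ⟨wt, F, hb, hwt⟩ := exists_isLevelBasis_gamma1pm N hN3
  have hkw : ∀ j, wt j ≤ k := fun j ↦ (wt_le_of_isLevelBasis hN3 hb hwt j).trans hk6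
  rw [← finrank_formSpace, ← formSpace_gamma1pm_eq_of_even N hk]
  exact twelve_mul_finrank_levelSpace_gamma1pm hN hb hwt hk hkw

/-- **`12 dim M_k(Γ₁(N)) ≥ (k-1)[SL₂(ℤ):±Γ₁(N)] + 6ε_∞(N)` for `N ≥ 4` and every even `k`**
(an equality for `k ≥ 6[SL₂(ℤ):±Γ₁(N)]`, `twelve_mul_finrank_modularForm_gamma1`).
[cite: DiamondShurman2005, Thm. 3.5.1] -/
theorem twelve_mul_finrank_modularForm_gamma1_ge (hN : 4 ≤ N) {k : ℤ} (hk : Even k) :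
    (k - 1) * (Gamma1pm N).index + 6 * (Level.basePoints (Gamma1pm N)).card ≤
      12 * (Module.finrank ℂ (ModularForm (Gamma1 N) k) : ℤ) := by
  have hN3 : 3 ≤ N := by omega
  obtain ⟨wt, F, hb, hwt⟩ := exists_isLevelBasis_gamma1pm N hN3
  rw [← finrank_formSpace, ← formSpace_gamma1pm_eq_of_even N hk]
  exact le_twelve_mul_finrank_levelSpace_gamma1pm hN hb hwt hk

/-- `S_k(±Γ₁(N))` is finite-dimensional (Sturm). [folklore] -/
instance finiteDimensional_cuspForm_gamma1pm (k : ℤ) : FiniteDimensional ℂ (CuspForm (Gamma1pm N) k) :=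
  (finiteDimensional_cuspForm_and_finrank_le (𝒢 := Gamma1pm N) (k := k)
    (Level.one_mem_strictPeriods (Gamma1pm N))).1

/-- `dim S_k(±Γ₁(N)) ≤ dim S_k(Γ₁(N))` (a cusp form on `±Γ₁(N)` is one on `Γ₁(N)`). [folklore] -/
theorem finrank_cuspForm_gamma1pm_le (k : ℤ) [FiniteDimensional ℂ (CuspForm (Gamma1 N) k)] :
    Module.finrank ℂ (CuspForm (Gamma1pm N) k) ≤ Module.finrank ℂ (CuspForm (Gamma1 N) k) := by
  let ι : CuspForm (Gamma1pm N) k →ₗ[ℂ] CuspForm (Gamma1 N) k :=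
    { toFun := fun f ↦
        { toFun := f
          slash_action_eq' := fun γ hγ ↦ by
            obtain ⟨g, hg, rfl⟩ := hγ
            exact f.slash_action_eq' _ ⟨g, gamma1_le_gamma1pm N hg, rfl⟩
          holo' := f.holo'
          zero_at_cusps' := fun {c} hc ↦ by
            rw [Subgroup.IsArithmetic.isCusp_iff_isCusp_SL2Z] at hc
            rw [OnePoint.isZeroAt_iff_forall_SL2Z hc]
            intro γ _
            have := CuspFormClass.zero_at_infty_slash f γ
            simpa [ModularForm.SL_slash] using this }
      map_add' := fun f g ↦ by ext τ; rfl
      map_smul' := fun c f ↦ by ext τ; rfl }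
  have hι : Function.Injective ι := by
    intro f g h
    ext τ
    exact congrArg (fun G : CuspForm (Gamma1 N) k ↦ G τ) h
  exact LinearMap.finrank_le_finrank_of_injective hι

/-- **`12 dim S_k(Γ₁(N)) ≥ (k-1)[SL₂(ℤ):±Γ₁(N)] - 6ε_∞(N)` for `N ≥ 4` and every even `k`** —
the existence half of Diamond–Shurman Thm. 3.5.1 / Fig. 3.4 for `Γ₁(N)` (`dim S_k = dim M_k - ε_∞`
for `k ≥ 4`, where the right-hand side is `12` times the exact dimension
`(k-1)(g-1) + (k/2 - 1)ε_∞`, `12(g-1) = μ₁ - 6ε_∞`), i.e. the dimension lower bound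
`dim S_k(Γ₁(N)) ≥ h_P/2`, `h_P = (k-1)μ₁/6 - ε_∞`, consumed by the rank half of Eichler–Shimura
on `Γ₁(N)`. [cite: DiamondShurman2005, Thm. 3.5.1] -/
theorem le_twelve_mul_finrank_cuspForm_gamma1 (hN : 4 ≤ N) {k : ℤ} (hk : Even k) :
    (k - 1) * (Gamma1pm N).index - 6 * (Level.basePoints (Gamma1pm N)).card ≤
      12 * (Module.finrank ℂ (CuspForm (Gamma1 N) k) : ℤ) := by
  have hT1 : ModularGroup.T ∈ Gamma1 N := by
    rw [Gamma1_mem]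
    simp [ModularGroup.T]
  have h1p : (1 : ℝ) ∈ ((Gamma1 N : Subgroup SL(2, ℤ)) : Subgroup (GL (Fin 2) ℝ)).strictPeriods := by
    rw [Subgroup.strictPeriods_eq_zmultiples_one_of_T_mem hT1]
    exact AddSubgroup.mem_zmultiples (1 : ℝ)
  haveI : FiniteDimensional ℂ (CuspForm (Gamma1 N) k) :=
    (finiteDimensional_cuspForm_and_finrank_le (𝒢 := Gamma1 N) (k := k) h1p).1
  have h1 := twelve_mul_finrank_modularForm_gamma1_ge N hN hk
  have h2 := Level.finrank_levelSpace_le_finrank_cuspForm_add (Gamma1pm N) k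
  have h3 := finrank_cuspForm_gamma1pm_le N k
  rw [← finrank_formSpace, ← formSpace_gamma1pm_eq_of_even N hk] at h1
  have h2' : (Module.finrank ℂ (formSpace (Gamma1pm N) k) : ℤ) ≤
      Module.finrank ℂ (CuspForm (Gamma1 N) k) + (Level.basePoints (Gamma1pm N)).card := by
    exact_mod_cast h2.trans (Nat.add_le_add_right h3 _)
  linarith

/-- The same bound for natural even weights `k ≥ 2`, divided through:
**`dim S_k(Γ₁(N)) ≥ (k-1)(g-1) + (k/2 - 1)ε_∞`** with `12(g-1) = μ₁ - 6ε_∞`, in the cleared form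
`(k-1)μ₁ ≤ 12 dim S_k(Γ₁(N)) + 6ε_∞` over `ℕ`. [cite: DiamondShurman2005, Thm. 3.5.1, Fig. 3.4] -/
theorem sub_one_mul_index_le_finrank_cuspForm_gamma1 (hN : 4 ≤ N) {k : ℕ} (hk : Even k) (hk1 : 1 ≤ k) :
    (k - 1) * (Gamma1pm N).index ≤
      12 * Module.finrank ℂ (CuspForm (Gamma1 N) k) + 6 * (Level.basePoints (Gamma1pm N)).card := by
  have h := le_twelve_mul_finrank_cuspForm_gamma1 N hN (k := k) (by exact_mod_cast hk)
  have hk' : ((k - 1 : ℕ) : ℤ) = (k : ℤ) - 1 := by push_cast [Nat.cast_sub hk1]; ring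
  have : (((k - 1) * (Gamma1pm N).index : ℕ) : ℤ) ≤
      ((12 * Module.finrank ℂ (CuspForm (Gamma1 N) k) + 6 * (Level.basePoints (Gamma1pm N)).card : ℕ) : ℤ) := by
    push_cast [Nat.cast_sub hk1]
    linarith
  exact_mod_cast this

end Gamma1Dimension

end Literature.NumberTheory.EllipticCurves.ModularForms
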